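import Mathlib
import HarnessLib.Audit
import Summits.PneNP.PneNP.Theorems.PstarCoreBoundTargets
import Summits.PneNP.PneNP.Theorems.PstarMaxSharingReaders

/-!
# The maximal-sharing rung, assembled by name: `TerminalPeelable ∧ TerminalFiveTight ⇒ TerminalFiveMaxSharing` (ROUND-24, memo §13.2)

FRONTIER range-avoidance ladder, rung F-N3, ROUND 24 (cell `pnp-ideate`, planner memo `r24/CORE-BOUND-NOTES.md` §13.2, §14; typed targets
`PstarCoreBoundTargets.TerminalFiveMaxSharing` / `TerminalPeelable` / `TerminalFiveA` (p646951); restricted-model proof complexity — nothing here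
bears on `P` versus `NP`).

What the maximal-sharing rung `TerminalFiveMaxSharing` (`2·#sharedSlots = #J₀ ⇒ #J₀ ≤ 5`) needs, as two NAMED nodes:

* O1: `TerminalPeelable` (no centre cycle; then a maximal leaf-peelable `F` with chord co-edges exists, `exists_maximal_peelable_sup`);
* the reader side: at maximal sharing the core is TIGHT, hence (`PstarMaxSharingReaders.readers_of_maxSharing_union`) no CROSS reader and every
  private-touching reader is a gate `(p, z)` with its partner `z` OUTSIDE the variables of the core.  `TerminalFiveTight` (OPEN, typed here) is
  `TerminalFiveA` restricted to exactly this reader structure — strictly between the landed `card_le_five_of_terminal'` (all privates unread)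
  and `TerminalFiveA` (arbitrary readers).  Its sub-case "one gate per chord, partner read by nothing else" is in tree
  (prover-1 `PstarFreshEraseGates.card_le_five_of_freshGates`; prover-2 `PstarFreshGateTerminalFive.card_le_five_of_freshGate_terminal` for a
  single gate in either or both constraints); what it still contains: partners shared with literal readers `(σ, z)`, `(z, z')` or read linearly
  (`z ∈ Cᵢ`), and several gates on one chord.

Glue proved here: `terminalFiveTight_of_terminalFiveA`, `terminalFiveMaxSharing_of_peelable_of_tight : TerminalPeelable → TerminalFiveTight →
TerminalFiveMaxSharing`, and `terminalFiveMaxSharing_of_tight_lt_twelve` (below twelve outputs O1 is automatic, so `TerminalFiveTight` alone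
settles the max-sharing cores of at most eleven outputs).
-/

set_option linter.dupNamespace false -- `Summit.PneNP.PneNP.…`: summit = sub-problem name (D-0017 single-conjunct layout)

open Finset Literature.Computability.Complexity
open Summit.PneNP.PneNP.Theorems.PstarTyped (Typed)
open Summit.PneNP.PneNP.Theorems.PstarSALevel (varSet bdry BoundaryExpanding SimpleOverlap)
open Summit.PneNP.PneNP.Theorems.PstarCoreBound (XorClosed)
open Summit.PneNP.PneNP.Theorems.PstarChordRepair (IsChord)
open Summit.PneNP.PneNP.Theorems.PstarChordBridgeTools (privs)
open Summit.PneNP.PneNP.Theorems.PstarChordBridgeCotree (Peelable)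
open Summit.PneNP.PneNP.Theorems.PstarChordBridgeCentre (exists_maximal_peelable_sup)
open Summit.PneNP.PneNP.Theorems.PstarSharingBound (sharedSlots)
open Summit.PneNP.PneNP.Theorems.PstarCoreBoundTargets
open Summit.PneNP.PneNP.Theorems.PstarMaxSharingReaders (readers_of_maxSharing_union)

namespace Summit.PneNP.PneNP.Theorems.PstarMaxSharingAssembly

variable {n m : ℕ}

/-- **TIGHT READER STRUCTURE** of a terminal core relative to its chord set `J₀ ∖ F`: no CROSS reader (both AND variables private), and every
reader touching a chord private in one AND slot carries in its other AND slot a variable of NO output of the core. -/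
def TightReaders (I : LocalMap 4 n m) (J₀ F : Finset (Fin m)) (w₁ w₂ : Finset (Fin n) × Finset (Fin m) × Bool) : Prop :=
  (∀ g ∈ w₁.2.1 ∪ w₂.2.1, ¬ (I.vars g 2 ∈ privs I (J₀ \ F) ∧ I.vars g 3 ∈ privs I (J₀ \ F))) ∧
  ∀ g ∈ w₁.2.1 ∪ w₂.2.1, ∀ s s' : Fin 4, 2 ≤ s.val → 2 ≤ s'.val → s ≠ s' → I.vars g s ∈ privs I (J₀ \ F) →
    ∀ j ∈ J₀, I.vars g s' ∉ varSet I j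

/-- **O2 AT TIGHT READERS (OPEN): `TerminalFiveA` restricted to the tight reader structure.**  A terminal core with a maximal leaf-peelable `F`
whose co-edges are chords, no CROSS reader, and every private-touching reader a gate with FRESH partner (outside the variables of the core),
has at most five outputs.  Sub-cases in tree: all privates unread (`card_le_five_of_terminal'`); one isolated gate per chord
(`PstarFreshEraseGates.card_le_five_of_freshGates`, `PstarFreshGateTerminalFive.card_le_five_of_freshGate_terminal`).  FRONTIER. -/
@[conjecture] def TerminalFiveTight : Prop :=
  ∀ (n m r : ℕ) (I : LocalMap 4 n m), I.IsPure xorAndPred → Typed I → SimpleOverlap I → BoundaryExpanding r I →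
    ∀ (y : Fin m → Bool) (J₀ : Finset (Fin m)) (w₁ w₂ : Finset (Fin n) × Finset (Fin m) × Bool), Terminal I r y J₀ w₁ w₂ →
    ∀ F ⊆ J₀, Peelable I F → (∀ F', F ⊆ F' → F' ⊆ J₀ → Peelable I F' → F' = F) → (∀ e ∈ J₀ \ F, IsChord I J₀ e) →
    TightReaders I J₀ F w₁ w₂ → J₀.card ≤ 5

/-- `TerminalFiveA` (arbitrary readers) trivially gives the tight-reader node. -/
theorem terminalFiveTight_of_terminalFiveA (h : TerminalFiveA) : TerminalFiveTight :=
  fun n m r I hI hT hS hB y J₀ w₁ w₂ ht F hF hP hmax hchord _ => h n m r I hI hT hS hB y J₀ w₁ w₂ ht F hF hP hmax hchord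

/-- **At maximal sharing the readers ARE tight** (`PstarMaxSharingReaders`), for any Assumption-A data. -/
theorem tightReaders_of_maxSharing (I : LocalMap 4 n m) {r : ℕ} (hB : BoundaryExpanding r I) {y : Fin m → Bool} {J₀ : Finset (Fin m)}
    {w₁ w₂ : Finset (Fin n) × Finset (Fin m) × Bool} (ht : Terminal I r y J₀ w₁ w₂) (hms : 2 * (sharedSlots I J₀).card = J₀.card)
    {F : Finset (Fin m)} (hchord : ∀ e ∈ J₀ \ F, IsChord I J₀ e) : TightReaders I J₀ F w₁ w₂ := by
  obtain ⟨h₁, h₂, h₃⟩ := readers_of_maxSharing_union I hB ht.2.1 hms hchord ht.2.2.2.1.symm ht.2.2.2.2.1.symm ht.2.2.2.2.2.1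
  refine ⟨fun g hg => ?_, h₃⟩
  rcases mem_union.1 hg with hg | hg
  · exact h₁ g hg
  · exact h₂ g hg

/-- **The maximal-sharing rung from its two named nodes**: O1 (`TerminalPeelable`) supplies Assumption A, maximal sharing makes the readers
tight, and `TerminalFiveTight` bounds the core. -/
theorem terminalFiveMaxSharing_of_peelable_of_tight (h₁ : TerminalPeelable) (h₂ : TerminalFiveTight) : TerminalFiveMaxSharing := by
  intro n m r I hI hT hS hB y J₀ w₁ w₂ ht hms
  classical
  obtain ⟨F, hS₀F, hFJ, hPF, hmax⟩ :=
    exists_maximal_peelable_sup I (nonchords_subset I J₀) (h₁ n m r I hI hT hS hB y J₀ w₁ w₂ ht)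
  have hchord : ∀ e ∈ J₀ \ F, IsChord I J₀ e := by
    intro e he
    rw [mem_sdiff] at he
    by_contra hc
    exact he.2 (hS₀F ((mem_nonchords I).2 ⟨he.1, hc⟩))
  exact h₂ n m r I hI hT hS hB y J₀ w₁ w₂ ht F hFJ hPF hmax hchord (tightReaders_of_maxSharing I hB ht hms hchord)

/-- **Below twelve outputs the tight-reader node alone settles the maximal-sharing rung** (Assumption A is automatic there,
`assumptionA_of_terminal_lt_twelve`). -/
theorem terminalFiveMaxSharing_of_tight_lt_twelve (h₂ : TerminalFiveTight) {n m r : ℕ} (I : LocalMap 4 n m) (hI : I.IsPure xorAndPred)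
    (hT : Typed I) (hS : SimpleOverlap I) (hB : BoundaryExpanding r I) {y : Fin m → Bool} {J₀ : Finset (Fin m)}
    {w₁ w₂ : Finset (Fin n) × Finset (Fin m) × Bool} (ht : Terminal I r y J₀ w₁ w₂) (hms : 2 * (sharedSlots I J₀).card = J₀.card)
    (hk : J₀.card < 12) : J₀.card ≤ 5 := by
  obtain ⟨F, hF, hP, hmax, hchord⟩ := assumptionA_of_terminal_lt_twelve I hI hT hS hB ht hk
  exact h₂ n m r I hI hT hS hB y J₀ w₁ w₂ ht F hF hP hmax hchord (tightReaders_of_maxSharing I hB ht hms hchord)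

end Summit.PneNP.PneNP.Theorems.PstarMaxSharingAssembly
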